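import Summits.QuantumFields.YangMills.Theorems.BalabanUVNodesN15CurvedGluingCubeDressedLandau
import Summits.QuantumFields.YangMills.Theorems.BalabanUVNodesN15BackgroundEntry2Letters
import Summits.QuantumFields.YangMills.Theorems.BalabanUVNodesN15BackgroundAveragingWords
import HarnessLib

/-!
# Route «BalabanUVNodes» (cluster K4 «SpineRates»), Track-A DAG node N15 = NE2, BACKGROUND LAYER — THE TWO LETTERS OF THE STRUCTURAL PERTURBATION `V̂ = unstackM C A + N∘pr₀` OF THE JET (the
# local first-order species plus a lettered base operator), BY NAME from the species rows ∕ fits and the base operator's letter ∕ defect — the `hV`, `hV′`, `hDV` inputs of files 23∕24 and of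
# this seat's `…RemainderRowAdjoint{,Defect,DefectAssembly}` for that perturbation

Cell `pub-ymgap`, seat `pub-ymgap-dag-n15-w5` (WIDTH SEAT w5 on node N15, director-ym R399 (3a) ∕ HUMAN RULING D-0149; adapter in this seat's (g)∕(g′) lineage, INTENT-3).  `bears_on: R4∕N15 ·
K3⁷ SpineGivenEndpointR13SepCoPH (stmt-QuantumFields-20544)`.  Filed `--kind proof --supports stmt-QuantumFields-20544 --as helper` — COUNT-NEUTRAL.  Theorems only; 0 `def`, 0 `sorry`.
Imports BY NAME dag-n15-w3 file 27 `…CubeDressedLandau` (`hasMaj_comp_projO_none`), dag-n15-c `…BackgroundEntry2Letters` (`hasMaj_exp_of_diagK`), `…BackgroundAveragingWords` (`idef_comp_projO`),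
B1b `…BackgroundPairSpaceMatrix` (`hasMaj_unstackM`, `hasMaj_idef_unstackM`, through the closure); nothing in the tree is modified, nothing re-declared.

WHY.  This seat's adjoint remainder rows (`hasMaj_dressedV_comp_commOp_cubeOp_out`, `hasMaj_idef_dressedV_comp_commOp_cubeOp_out`) are STRUCTURAL in the perturbation: `V̂ = unstackM C A + N_V∘pr₀`
— and display its pair letter `V̂ ≤ Re^{−δ_Vd}` (files 23∕25's `hV`, at both grids) and its defect `𝔇(V̂′, V̂) ≤ oe^{−δ_Vd}` (file 24's `hDV`) as single hypotheses.  The two theorems below supply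
them from the data a knit holds anyway: the species' max-row-sum letters `Σ_k|C_{ik}|, Σ_k|A^±_{μ,ik}| ≤ r` (B1b `hasMaj_unstackM`: `diagK r(1 + |J ⊕ J|)`) and fits `≤ o` (`hasMaj_idef_unstackM`), the
base operator's letter `N ≤ R_N·e^{−δ_Nd}` read on the `none` component (file 27 `hasMaj_comp_projO_none`) and its defect `𝔇(N′, N) ≤ r_N·e^{−δ_Nd}` (`idef_comp_projO`); a diagonal majorant is
an exponential one at every rate (`hasMaj_exp_of_diagK`, `d(y, y) = 0`).  The nearest existing statements, dag-n15-c `BackgroundLayer.hasMaj_sub_word` ∕ `hasMaj_idef_sub_word`, treat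
`V̂₁ − W∘pr₀` with DIAGONAL letters on both summands; here the base summand is nonlocal with an exponential letter.
* ★ `hasMaj_unstackM_add_base` (`unstackM C A + N∘pr₀ ≤ (r(1 + |J ⊕ J|) + R_N)·e^{−δ_Nd}`), ★ `hasMaj_idef_unstackM_add_base` (`𝔇(unstackM C′ A′ + N′∘pr₀, unstackM C A + N∘pr₀) ≤ (o(1 + |J ⊕ J|) + r_N)·e^{−δ_Nd}`).

HONEST FRAMING ∕ LIMITS.  Block-majorant bookkeeping over DISPLAYED letters (species rows∕fits, the base operator's letter∕defect); [B9] (3.52) p. 400, (3.63)–(3.65) pp. 402–403, (3.76)–(3.77)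
pp. 405–406 = SHAPES — nothing of [B5]∕[B6]∕[B9] asserted.  NE2⁺ NOT PRINTED, NOT proved; N15 NOT discharged; counts of record UNMOVED (typed 28∕28 · discharged 5∕27); no summit statement is proved
here; one finite 𝕋⁴ at fixed ε — NOT infinite volume, NOT OS on ℝ⁴, NOT a mass gap, NOT Clay; R4 closes the conditional finite-𝕋⁴ rung `BalabanLadder.UV` only.  Restate-immune (no Theses import).
-/

set_option autoImplicit false

noncomputable section
open scoped BigOperators
open Finset

namespace Summit.QuantumFields.YangMills.BalabanUVNodes.N15.CurvedSpecies

open Literature.MathematicalPhysics.QuantumFieldTheory.Balaban1983to89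
open Literature.MathematicalPhysics.QuantumFieldTheory.Balaban1983to89.B11SectG (BlockNorm HasMaj)
open Literature.MathematicalPhysics.QuantumFieldTheory.Balaban1983to89.T4EtaRateDefect (idef idef_add)
open Literature.MathematicalPhysics.QuantumFieldTheory.Balaban1983to89.T4EtaRateCoeffDefect (pull diagK)
open Summit.QuantumFields.YangMills.BalabanUVNodes.N15.MatrixSpecies (liftBlk liftMap)
open Summit.QuantumFields.YangMills.BalabanUVNodes.N15.BackgroundLayer (projO blkPair liftPair unstackM hasMaj_unstackM hasMaj_idef_unstackM hasMaj_exp_of_diagK idef_comp_projO)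

section Letters

variable {X X' ι J : Type} [Fintype X] [Fintype X'] [Fintype ι] [Fintype J] {g : B6.Geometry} (blk : X → g.Site) (π : X' → X)

/-- ★ **THE PAIR LETTER OF THE STRUCTURAL PERTURBATION** (files 23∕25's `hV` for `V̂ := unstackM C A + N∘pr₀`): species rows `Σ_k|C(x)_{ik}|, Σ_k|A_j(x)_{ik}| ≤ r`, a base operator `N ≤ R_N·e^{−δ_Nd}`,
`d(y, y) = 0` ⟹ `unstackM C A + N∘pr₀ ≤ (r(1 + |J ⊕ J|) + R_N)·e^{−δ_Nd}` (pair blocks → base blocks). [cite: Balaban1985BackgroundPropagators, (3.52) p.400, (3.76)–(3.77) pp.405–406 (shapes)] -/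
theorem hasMaj_unstackM_add_base (hd0 : ∀ y : g.Site, g.dist y y = 0) {C : X → Matrix ι ι ℝ} {A : J ⊕ J → X → Matrix ι ι ℝ} {N : (X × ι → ℝ) →ₗ[ℝ] (X × ι → ℝ)} {r RN δN : ℝ}
    (hr : 0 ≤ r) (hRN : 0 ≤ RN) (hC : ∀ x i, ∑ k, |C x i k| ≤ r) (hA : ∀ j x i, ∑ k, |A j x i k| ≤ r)
    (hN : HasMaj (BlockNorm.ofBlocks g (liftBlk blk ι)) (BlockNorm.ofBlocks g (liftBlk blk ι)) N (fun y y' => RN * Real.exp (-(δN * g.dist y y')))) :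
    HasMaj (BlockNorm.ofBlocks g (blkPair (liftBlk blk ι))) (BlockNorm.ofBlocks g (liftBlk blk ι)) (unstackM C A + N ∘ₗ projO (none : Option (J ⊕ J)))
      (fun y y' => (r * (1 + Fintype.card (J ⊕ J)) + RN) * Real.exp (-(δN * g.dist y y'))) := by
  have hr' : 0 ≤ r * (1 + Fintype.card (J ⊕ J)) := by positivity
  have hU : HasMaj (BlockNorm.ofBlocks g (blkPair (liftBlk blk ι))) (BlockNorm.ofBlocks g (liftBlk blk ι)) (unstackM C A)
      (diagK fun _ => r * (1 + Fintype.card (J ⊕ J))) := hasMaj_unstackM blk hr hC hA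
  have t1 := hasMaj_exp_of_diagK (liftBlk blk ι) hd0 hr' δN hU
  have t2 : HasMaj (BlockNorm.ofBlocks g (blkPair (liftBlk blk ι))) (BlockNorm.ofBlocks g (liftBlk blk ι)) (N ∘ₗ projO (none : Option (J ⊕ J)))
      (fun y y' => RN * Real.exp (-(δN * g.dist y y'))) := hasMaj_comp_projO_none blk (fun _ _ => mul_nonneg hRN (Real.exp_nonneg _)) hN
  refine (t1.add t2).mono fun y y' => le_of_eq ?_
  ring

/-- ★ **THE DEFECT OF THE STRUCTURAL PERTURBATION ALONG `π`** (file 24's `hDV` for `V̂ := unstackM C A + N∘pr₀`, `V̂′ := unstackM C′ A′ + N′∘pr₀`): species fits `Σ_k|C′(x′) − C(πx′)|_{ik},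
Σ_k|A′_j(x′) − A_j(πx′)|_{ik} ≤ o`, the base operator's defect `𝔇(N′, N) ≤ r_N·e^{−δ_Nd}` (through `(pull (liftMap π ι), pull (liftMap π ι))`), `d(y, y) = 0` ⟹
`𝔇(V̂′, V̂) ≤ (o(1 + |J ⊕ J|) + r_N)·e^{−δ_Nd}` through `(pull (liftPair (liftMap π ι)), pull (liftMap π ι))`. [cite: Balaban1985BackgroundPropagators, (3.52) p.400, Thm 3.14 pp.426–427 (difference template)] -/
theorem hasMaj_idef_unstackM_add_base (hd0 : ∀ y : g.Site, g.dist y y = 0) {C : X → Matrix ι ι ℝ} {A : J ⊕ J → X → Matrix ι ι ℝ} {C' : X' → Matrix ι ι ℝ} {A' : J ⊕ J → X' → Matrix ι ι ℝ}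
    {N : (X × ι → ℝ) →ₗ[ℝ] (X × ι → ℝ)} {N' : (X' × ι → ℝ) →ₗ[ℝ] (X' × ι → ℝ)} {o rN δN : ℝ} (ho : 0 ≤ o) (hrN : 0 ≤ rN)
    (hC : ∀ x' i, ∑ k, |C' x' i k - C (π x') i k| ≤ o) (hA : ∀ j x' i, ∑ k, |A' j x' i k - A j (π x') i k| ≤ o)
    (hDN : HasMaj (BlockNorm.ofBlocks g (liftBlk blk ι)) (BlockNorm.ofBlocks g (liftBlk (blk ∘ π) ι)) (idef (pull (liftMap π ι)) (pull (liftMap π ι)) N' N)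
      (fun y y' => rN * Real.exp (-(δN * g.dist y y')))) :
    HasMaj (BlockNorm.ofBlocks g (blkPair (liftBlk blk ι))) (BlockNorm.ofBlocks g (liftBlk (blk ∘ π) ι))
      (idef (pull (liftPair (liftMap π ι))) (pull (liftMap π ι)) (unstackM C' A' + N' ∘ₗ projO (none : Option (J ⊕ J))) (unstackM C A + N ∘ₗ projO (none : Option (J ⊕ J))))
      (fun y y' => (o * (1 + Fintype.card (J ⊕ J)) + rN) * Real.exp (-(δN * g.dist y y'))) := by
  have ho' : 0 ≤ o * (1 + Fintype.card (J ⊕ J)) := by positivity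
  have hU : HasMaj (BlockNorm.ofBlocks g (blkPair (liftBlk blk ι))) (BlockNorm.ofBlocks g (liftBlk (blk ∘ π) ι))
      (idef (pull (liftPair (liftMap π ι))) (pull (liftMap π ι)) (unstackM C' A') (unstackM C A)) (diagK fun _ => o * (1 + Fintype.card (J ⊕ J))) :=
    hasMaj_idef_unstackM blk π ho hC hA
  have t1 := hasMaj_exp_of_diagK (liftBlk (blk ∘ π) ι) hd0 ho' δN hU
  have t2 : HasMaj (BlockNorm.ofBlocks g (blkPair (liftBlk blk ι))) (BlockNorm.ofBlocks g (liftBlk (blk ∘ π) ι))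
      (idef (pull (liftPair (liftMap π ι))) (pull (liftMap π ι)) (N' ∘ₗ projO (none : Option (J ⊕ J))) (N ∘ₗ projO (none : Option (J ⊕ J))))
      (fun y y' => rN * Real.exp (-(δN * g.dist y y'))) := by
    rw [idef_comp_projO]
    exact hasMaj_comp_projO_none blk (fun _ _ => mul_nonneg hrN (Real.exp_nonneg _)) hDN
  rw [idef_add]
  refine (t1.add t2).mono fun y y' => le_of_eq ?_
  ring

end Letters

end Summit.QuantumFields.YangMills.BalabanUVNodes.N15.CurvedSpecies

end
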